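import Literature.NumberTheory.Automorphic.AshSmithTheoryHeckeFrobeniusProofs
import Summits.BirchSwinnertonDyer.Rank1Residual.Additive.ZpTowerPlaceCountCore
import Summits.BirchSwinnertonDyer.Rank1Residual.Additive.ZpTowerSeam
import Summits.BirchSwinnertonDyer.Rank1Residual.X2.GreenbergVatsalUnramifiedAway
import HarnessLib

/-!
# T-E3g-BUDn-K (iv): r2's place count D-n.1 — `#{w ∣ v in K_n} · p^{n − v_p κ(Frob_v)} = pⁿ`
# (cell `b2b-bsdres`, n1011, p01 GEN 2)

HONEST FRAMING (cell `b2b-bsdres`, verbatim in every file): prove what is provable now; nothing is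
booked; no label changes. THEOREMS ONLY; NO Literature fact; no `sorry`. r2 ROUTE-2 §II.17.3 D-n.1:
for the cyclotomic `ℤ_p`-extension `κ` of `ℚ`, `l ≠ p`, `#{w ∣ l in ℚ_n} = p^{min(n, n_l)}`,
`n_l = v_p(l^{p−1} − 1) − 1` (odd `p`). Assembly of the tree's pieces:
* `finrank_eq_sum_inertiaDeg` — for a finite Galois extension of number fields `F/K` and a place
  `v` of `K` with `I_𝔓 ≤ res(Γ_F)` (unramified): `[F : K] = Σ_{w ∣ v} f(w|v)` — the DEGREE of the
  tree's Frobenius characteristic polynomial identity for the induction of the trivial character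
  (`FramedGaloisRep.exists_charpoly_induce_eq_prod`, Neukirch VII §10);
* `inertiaDeg_eq_orderOf` — every `f(w|v)` is the order of `Frob_𝔓` modulo `res(Γ_F)`
  (`Ash2003.orderOf_frobenius_eq_inertiaDeg`), hence `#{w ∣ v} · ord(Frob) = [F : K]`
  (`card_placesOver_mul_orderOf_eq_finrank`);
* for `F = K_n = κ.layer n`: `res(Γ_{K_n}) = galRange K_n = κ⁻¹(pⁿℤ_p)` (the SEAM
  `galRange_layer_eq_layerSubgroup`), `[K_n : K] = pⁿ` (`finrank_layer_holds`), the order of `Frob`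
  is `p^{n − m}` when `κ(Frob) = p^m·unit` (`orderOf_mk_layerSubgroup`), and `I_{𝔓₀} ≤ ker κ ≤
  κ⁻¹(pⁿℤ_p)` for `κ` cyclotomic and `v ∤ p` (X2 `inertia_le_kerSubgroup_of_isCyclotomic`): so
  `#{w ∣ v in K_n} · p^{n − m} = pⁿ` (`card_placesOver_layer_mul_pow_eq`);
* over `ℚ`: `m` is read off `‖N(v)^t − 1‖` (`norm_toAdd_frob_mul_of_isCyclotomic`), giving
  `card_placesOver_layer_mul_pow_eq_rat` with the hypothesis
  `‖N(v)^t − 1‖ = ‖t‖·‖p^{e₀}‖·p^{−m}` (`= p^{−(m+1)}` for odd `p`, i.e. `m = n_l`), and for odd `p`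
  the `padicValNat`-certificate form `card_placesOver_layer_mul_pow_eq_rat_of_padicValNat`
  (`v_p(N(v)^{p−1} − 1) = m + 1 ⟹ #{w ∣ v in ℚ_n} · p^{n − m} = pⁿ`).
References: [Washington1997] §13.1; [NeukirchANT1999] I §9, VII §10.
-/

noncomputable section

open scoped NumberField Pointwise
open IsDedekindDomain Field Literature.NumberTheory.GaloisRepresentations

namespace Summit.BirchSwinnertonDyer.Rank1Residual.Additive.ZpTower

/-! ### `[F : K] = Σ_{w ∣ v} f(w|v)` and `f(w|v) = ord(Frob)` at an unramified place -/

section General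

variable (K : Type) {F : Type} [Field K] [NumberField K] [Field F] [NumberField F] [Algebra K F]
  [FiniteDimensional K F] [IsGalois K F]

/-- **`[F : K] = Σ_{w ∣ v} f(w|v)`** for `F/K` finite Galois and `v` with `I_𝔓 ≤ res(Γ_F)`: the degree
of the identity `det(X − Ind_{Γ_F}^{Γ_K} 𝟙 (Frob)) = ∏_{w ∣ v} (X^{f(w|v)} − 1)`
(`FramedGaloisRep.exists_charpoly_induce_eq_prod` for the trivial character over `ℚ`).
[cite: NeukirchANT1999, Ch. VII §10 Prop. (10.4)] -/
theorem finrank_eq_sum_inertiaDeg {v : HeightOneSpectrum (𝓞 K)} {𝔓 : Ideal (absIntegers (𝓞 K) K)}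
    (h𝔓 : 𝔓 ∈ v.primesAbove)
    (hI : 𝔓.inertia (absoluteGaloisGroup K) ≤ (absGaloisRestrict K F).toMonoidHom.range)
    [Fintype {w : HeightOneSpectrum (𝓞 F) // w.under (𝓞 K) = v}] :
    Module.finrank K F =
      ∑ w : {w : HeightOneSpectrum (𝓞 F) // w.under (𝓞 K) = v}, w.1.asIdeal.inertiaDeg (𝓞 K) := by
  classical
  obtain ⟨σ, hσ⟩ := HeightOneSpectrum.exists_isArithFrobAt_of_mem_primesAbove_holds h𝔓
  obtain ⟨𝔔, s, -, hchar⟩ := FramedGaloisRep.exists_charpoly_induce_eq_prod K rfl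
    (1 : FramedGaloisRep F ℚ 1) h𝔓 hI hσ
  haveI : Module.Finite (𝓞 K) (𝓞 F) := IsIntegralClosure.finite (𝓞 K) K F (𝓞 F)
  have hmonic : ∀ w : {w : HeightOneSpectrum (𝓞 F) // w.under (𝓞 K) = v},
      (Polynomial.X ^ (w.1.asIdeal.inertiaDeg (𝓞 K)) -
        Polynomial.C ((((1 : FramedGaloisRep F ℚ 1) (s w) : GL (Fin 1) ℚ) :
          Matrix (Fin 1) (Fin 1) ℚ) 0 0)).Monic := fun w =>
    Polynomial.monic_X_pow_sub_C _ (Ideal.inertiaDeg_pos _ _).ne'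
  have hdeg := congrArg Polynomial.natDegree hchar
  rw [FramedRep.charpoly, Matrix.charpoly_natDegree_eq_dim, Fintype.card_fin, mul_one,
    Polynomial.natDegree_prod_of_monic _ _ (fun w _ => hmonic w)] at hdeg
  rw [hdeg]
  exact Finset.sum_congr rfl fun w _ => Polynomial.natDegree_X_pow_sub_C

-- as in `AshSmithTheoryHeckeFrobeniusProofs`: the pointwise `Γ_K`-action on ideals of `\bar ℤ_K`
-- is slow to synthesize in this import context
set_option synthInstance.maxHeartbeats 80000 in
omit [FiniteDimensional K F] [IsGalois K F] in
/-- **`f(w|v) = ord(Frob_𝔓 mod res(Γ_F))`** for EVERY place `w ∣ v` of `F` (unramified case):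
the tree's `Ash2003.orderOf_frobenius_eq_inertiaDeg` with its auxiliary data (a prime `𝔔 ∣ w` of
`\bar ℤ_F`, `τ ∈ Γ_K` moving it to `𝔓`, and `s ∈ Γ_F` over `τ⁻¹ Frob^f τ`) constructed as in the
proof of `FramedGaloisRep.exists_charpoly_induce_eq_prod`. [cite: NeukirchANT1999, Ch. I §9 Prop. (9.4)] -/
theorem inertiaDeg_eq_orderOf (hN : (absGaloisRestrict K F).toMonoidHom.range.Normal)
    {v : HeightOneSpectrum (𝓞 K)} {𝔓 : Ideal (absIntegers (𝓞 K) K)} (h𝔓 : 𝔓 ∈ v.primesAbove)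
    (hI : 𝔓.inertia (absoluteGaloisGroup K) ≤ (absGaloisRestrict K F).toMonoidHom.range)
    {σ : absoluteGaloisGroup K} (hσ : IsArithFrobAt (𝓞 K) σ 𝔓)
    (w : HeightOneSpectrum (𝓞 F)) (hw : w.under (𝓞 K) = v) :
    w.asIdeal.inertiaDeg (𝓞 K) =
      orderOf (σ : absoluteGaloisGroup K ⧸ (absGaloisRestrict K F).toMonoidHom.range) := by
  haveI : 𝔓.IsPrime := h𝔓.1
  have hwv : w.asIdeal.under (𝓞 K) = v.asIdeal := congrArg HeightOneSpectrum.asIdeal hw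
  obtain ⟨𝔔, h𝔔⟩ := w.primesAbove_nonempty
  obtain ⟨τ, hτ⟩ := HeightOneSpectrum.exists_smul_eq_of_mem_primesAbove_holds
    (comap_absIntegersMap_mem_primesAbove hwv h𝔔) h𝔓
  -- `ι⁻¹ 𝔔 = τ⁻¹ 𝔓` (from `τ • ι⁻¹ 𝔔 = 𝔓`; stated through `smul_eq_iff_eq_inv_smul` so that the
  -- pointwise `Γ_K`-action on ideals of `\bar ℤ_K` is the instance already carried by `hτ`)
  have hcomap := (smul_eq_iff_eq_inv_smul τ).mp hτ
  have hσf : σ ^ orderOf (σ : absoluteGaloisGroup K ⧸ (absGaloisRestrict K F).toMonoidHom.range) ∈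
      (absGaloisRestrict K F).toMonoidHom.range := by
    rw [← QuotientGroup.eq_one_iff, QuotientGroup.mk_pow]
    exact pow_orderOf_eq_one _
  obtain ⟨s, hs⟩ : ∃ s : absoluteGaloisGroup F, absGaloisRestrict K F s =
      τ⁻¹ * σ ^ orderOf (σ : absoluteGaloisGroup K ⧸ (absGaloisRestrict K F).toMonoidHom.range)
        * τ := by
    have h := hN.conj_mem _ hσf τ⁻¹
    rw [inv_inv] at h
    exact h
  exact (Literature.NumberTheory.Automorphic.Ash2003.orderOf_frobenius_eq_inertiaDeg K F hN h𝔓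
    hI hσ hwv h𝔔 hcomap hs).1.symm

/-- **`#{w ∣ v} · ord(Frob) = [F : K]`** at an unramified place of a finite Galois extension of
number fields. [cite: NeukirchANT1999, Ch. I §9 Prop. (9.4)] -/
theorem card_placesOver_mul_orderOf_eq_finrank (hN : (absGaloisRestrict K F).toMonoidHom.range.Normal)
    {v : HeightOneSpectrum (𝓞 K)} {𝔓 : Ideal (absIntegers (𝓞 K) K)} (h𝔓 : 𝔓 ∈ v.primesAbove)
    (hI : 𝔓.inertia (absoluteGaloisGroup K) ≤ (absGaloisRestrict K F).toMonoidHom.range)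
    {σ : absoluteGaloisGroup K} (hσ : IsArithFrobAt (𝓞 K) σ 𝔓)
    [Fintype {w : HeightOneSpectrum (𝓞 F) // w.under (𝓞 K) = v}] :
    Fintype.card {w : HeightOneSpectrum (𝓞 F) // w.under (𝓞 K) = v} *
        orderOf (σ : absoluteGaloisGroup K ⧸ (absGaloisRestrict K F).toMonoidHom.range) =
      Module.finrank K F := by
  rw [finrank_eq_sum_inertiaDeg K h𝔓 hI,
    Finset.sum_congr rfl (fun w _ => inertiaDeg_eq_orderOf K hN h𝔓 hI hσ w.1 w.2),
    Finset.sum_const, Finset.card_univ, smul_eq_mul]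

/-- Orders in quotients by equal normal subgroups agree. [folklore] -/
theorem orderOf_mk_congr {G : Type*} [Group G] {H₁ H₂ : Subgroup G} (hH₁ : H₁.Normal)
    (hH₂ : H₂.Normal) (h : H₁ = H₂) (g : G) :
    orderOf (QuotientGroup.mk (s := H₁) g) = orderOf (QuotientGroup.mk (s := H₂) g) := by
  subst h
  rfl

end General

/-! ### The layer `K_n` of a `ℤ_p`-extension -/

open Literature.NumberTheory.EllipticCurves Literature.NumberTheory.EllipticCurves.CyclotomicZp

section Layer

variable {K : Type} [Field K] [NumberField K] {p : ℕ} [Fact p.Prime] (κ : ZpExtension K p) (n : ℕ)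

/-- `res(Γ_{K_n}) = κ⁻¹(pⁿℤ_p)` (`resGal = absGaloisRestrict` and the SEAM). [cite: Washington1997, §13.1] -/
theorem range_absGaloisRestrict_layer :
    (absGaloisRestrict K (κ.layer n)).toMonoidHom.range = κ.layerSubgroup n := by
  rw [← galRange_layer_eq_layerSubgroup κ n]
  rfl

/-- **Place count in the layer, abstract form.** For a `ℤ_p`-extension `κ` of a number field `K`,
a place `v` of `K`, a prime `𝔓 ∣ v` of `\bar ℤ_K` whose inertia group lies in `ker κ` (`v`
unramified in `K_∞`), and an arithmetic Frobenius `σ` at `𝔓` with `κ(σ) = p^m · u`, `u ∈ ℤ_pˣ`: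
`#{w ∣ v in K_n} · p^{n − m} = pⁿ` (truncated subtraction), i.e. `#{w ∣ v} = p^{min(n, m)}`.
[cite: Washington1997, §13.1] [cite: NeukirchANT1999, Ch. I §9 Prop. (9.4)] -/
theorem card_placesOver_layer_mul_pow_eq {v : HeightOneSpectrum (𝓞 K)}
    {𝔓 : Ideal (absIntegers (𝓞 K) K)} (h𝔓 : 𝔓 ∈ v.primesAbove)
    (hI : 𝔓.inertia (absoluteGaloisGroup K) ≤ κ.kerSubgroup)
    {σ : absoluteGaloisGroup K} (hσ : IsArithFrobAt (𝓞 K) σ 𝔓)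
    {m : ℕ} {u : ℤ_[p]} (hu : IsUnit u) (hσm : (κ σ).toAdd = (p : ℤ_[p]) ^ m * u) :
    Nat.card {w : HeightOneSpectrum (𝓞 (κ.layer n)) // w.under (𝓞 K) = v} * p ^ (n - m) =
      p ^ n := by
  haveI : Fintype {w : HeightOneSpectrum (𝓞 (κ.layer n)) // w.under (𝓞 K) = v} :=
    @Fintype.ofFinite _ (finite_heightOneSpectrum_under_eq v)
  rw [Nat.card_eq_fintype_card]
  have hrange := range_absGaloisRestrict_layer κ n
  have hN : (absGaloisRestrict K (κ.layer n)).toMonoidHom.range.Normal := by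
    rw [hrange]; infer_instance
  have hI' : 𝔓.inertia (absoluteGaloisGroup K) ≤
      (absGaloisRestrict K (κ.layer n)).toMonoidHom.range := by
    rw [hrange]
    exact hI.trans (κ.kerSubgroup_le_layerSubgroup n)
  have h := card_placesOver_mul_orderOf_eq_finrank K hN h𝔓 hI' hσ
  rw [orderOf_mk_congr hN inferInstance hrange σ, orderOf_mk_layerSubgroup κ n σ hu hσm] at h
  rw [h]
  exact κ.finrank_layer_holds n

/-- `I_{𝔓₀} ≤ ker κ` for the cyclotomic `ℤ_p`-extension and `v ∤ p` (`𝔓₀ = adicCompletionPrime K v`;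
X2 `inertia_le_kerSubgroup_of_isCyclotomic`). [cite: Washington1997, §13.1] -/
theorem inertia_adicCompletionPrime_le_kerSubgroup (hκ : κ.IsCyclotomic)
    {v : HeightOneSpectrum (𝓞 K)} (hv : ((p : ℕ) : 𝓞 K) ∉ v.asIdeal) :
    (adicCompletionPrime K v).inertia (absoluteGaloisGroup K) ≤ κ.kerSubgroup := by
  rw [inertia_adicCompletionPrime_eq_map_absInertia]
  exact X2.GreenbergVatsalUnramifiedAway.inertia_le_kerSubgroup_of_isCyclotomic κ v hκ hv

end Layer

/-! ### Over `ℚ`: the exponent from `‖N(v)^t − 1‖` -/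

section Rat

variable {p : ℕ} [Fact p.Prime] (κ : ZpExtension ℚ p) (n : ℕ)

/-- **r2's place count D-n.1 (kernel form).** For the cyclotomic `ℤ_p`-extension `κ` of `ℚ`, a
finite place `v ∤ p` of `ℚ` and `m : ℕ` with `‖N(v)^t − 1‖ = ‖t‖·‖p^{e₀}‖·p^{−m}` (`t = #μ(ℤ_p)`,
`γ_cyc = 1 + p^{e₀}`; for odd `p`: `v_p(N(v)^{p−1} − 1) = m + 1`, i.e. `m = n_l` for `v = (l)`):
`#{w ∣ v in ℚ_n} · p^{n − m} = pⁿ`, so `#{w ∣ v in ℚ_n} = p^{min(n, n_l)}`.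
[cite: Washington1997, §13.1] [cite: NeukirchANT1999, Ch. I §9 Prop. (9.4)] -/
theorem card_placesOver_layer_mul_pow_eq_rat (hκ : κ.IsCyclotomic) {v : HeightOneSpectrum (𝓞 ℚ)}
    (hv : ((p : ℕ) : 𝓞 ℚ) ∉ v.asIdeal) {m : ℕ}
    (hm : ‖((v.residueCard : ℕ) : ℤ_[p]) ^ torsionOrder p - 1‖ =
      ‖((torsionOrder p : ℕ) : ℤ_[p])‖ * ‖(p : ℤ_[p]) ^ cyclotomicExponent p‖ *
        (p : ℝ) ^ (-(m : ℤ))) :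
    Nat.card {w : HeightOneSpectrum (𝓞 (κ.layer n)) // w.under (𝓞 ℚ) = v} * p ^ (n - m) =
      p ^ n := by
  have h𝔓 := adicCompletionPrime_mem_primesAbove ℚ v
  obtain ⟨σ, hσ⟩ := HeightOneSpectrum.exists_isArithFrobAt_of_mem_primesAbove_holds h𝔓
  -- the valuation of `κ σ`
  have hnorm := norm_toAdd_frob_mul_of_isCyclotomic p κ hκ hv h𝔓 hσ
  rw [hm] at hnorm
  have ht : ‖((torsionOrder p : ℕ) : ℤ_[p])‖ ≠ 0 := by
    rw [norm_ne_zero_iff]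
    exact_mod_cast (Nat.totient_pos.mpr (pow_pos (Fact.out : p.Prime).pos _)).ne'
  have he : ‖(p : ℤ_[p]) ^ cyclotomicExponent p‖ ≠ 0 := by
    rw [norm_ne_zero_iff]
    exact pow_ne_zero _ (Nat.cast_ne_zero.mpr (Fact.out : p.Prime).ne_zero)
  have hσm : ‖(κ σ).toAdd‖ = (p : ℝ) ^ (-(m : ℤ)) := by
    have h2 : ‖(κ σ).toAdd‖ * (‖((torsionOrder p : ℕ) : ℤ_[p])‖ * ‖(p : ℤ_[p]) ^ cyclotomicExponent p‖) =
        (p : ℝ) ^ (-(m : ℤ)) * (‖((torsionOrder p : ℕ) : ℤ_[p])‖ * ‖(p : ℤ_[p]) ^ cyclotomicExponent p‖) := by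
      rw [← mul_assoc, hnorm]; ring
    exact mul_right_cancel₀ (mul_ne_zero ht he) h2
  -- `κ σ = p^m · unit`
  have hne : (κ σ).toAdd ≠ 0 := by
    intro h0
    rw [h0, norm_zero] at hσm
    exact (zpow_pos (by exact_mod_cast (Fact.out : p.Prime).pos) _).ne' hσm.symm
  have hval : (κ σ).toAdd.valuation = m := by
    have h := PadicInt.norm_eq_zpow_neg_valuation hne
    rw [hσm] at h
    have := zpow_right_injective₀ (by exact_mod_cast (Fact.out : p.Prime).pos)
      (by exact_mod_cast (Fact.out : p.Prime).one_lt.ne') h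
    omega
  have hdec : (κ σ).toAdd = (p : ℤ_[p]) ^ m * PadicInt.unitCoeff hne := by
    conv_lhs => rw [PadicInt.unitCoeff_spec hne, hval]
    ring
  exact card_placesOver_layer_mul_pow_eq κ n h𝔓 (inertia_adicCompletionPrime_le_kerSubgroup κ hκ hv)
    hσ (PadicInt.unitCoeff hne).isUnit hdec

/-- `‖k‖ = p^{−v_p(k)}` in `ℤ_p` for a non-zero natural number `k`. [folklore] -/
theorem norm_natCast_eq_zpow_neg_padicValNat {k : ℕ} (hk : k ≠ 0) :
    ‖(k : ℤ_[p])‖ = (p : ℝ) ^ (-(padicValNat p k : ℤ)) := by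
  have hk' : (k : ℤ_[p]) ≠ 0 := Nat.cast_ne_zero.mpr hk
  rw [PadicInt.norm_eq_zpow_neg_valuation hk']
  congr 2
  have h := PadicInt.valuation_coe (k : ℤ_[p])
  rw [PadicInt.coe_natCast, Padic.valuation_natCast] at h
  exact_mod_cast h.symm

/-- For ODD `p` the hypothesis of `card_placesOver_layer_mul_pow_eq_rat` is the `padicValNat`
certificate `v_p(N^{p−1} − 1) = m + 1` (`t = p − 1` is a `p`-adic unit, `e₀ = 1`). [folklore] -/
theorem norm_pow_torsionOrder_sub_one_of_padicValNat (hp : p ≠ 2) {N m : ℕ}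
    (hval : padicValNat p (N ^ (p - 1) - 1) = m + 1) :
    ‖((N : ℕ) : ℤ_[p]) ^ torsionOrder p - 1‖ =
      ‖((torsionOrder p : ℕ) : ℤ_[p])‖ * ‖(p : ℤ_[p]) ^ cyclotomicExponent p‖ *
        (p : ℝ) ^ (-(m : ℤ)) := by
  have hprime : p.Prime := Fact.out
  have he : cyclotomicExponent p = 1 := by unfold cyclotomicExponent; simp [hp]
  have htor : torsionOrder p = p - 1 := by rw [torsionOrder, he, pow_one, Nat.totient_prime hprime]
  have hk : N ^ (p - 1) - 1 ≠ 0 := by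
    intro h0
    rw [h0, padicValNat_zero_right] at hval
    exact Nat.succ_ne_zero m hval.symm
  have hN1 : 1 ≤ N ^ (p - 1) := by omega
  have hcast : ((N : ℕ) : ℤ_[p]) ^ torsionOrder p - 1 = ((N ^ (p - 1) - 1 : ℕ) : ℤ_[p]) := by
    rw [htor, Nat.cast_sub hN1, Nat.cast_pow, Nat.cast_one]
  have ht : ‖((torsionOrder p : ℕ) : ℤ_[p])‖ = 1 := by
    rw [htor, PadicInt.norm_natCast_eq_one_iff]
    exact (Nat.coprime_self_sub_right hprime.one_le).mpr (Nat.coprime_one_right p)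
  rw [hcast, norm_natCast_eq_zpow_neg_padicValNat hk, hval, ht, one_mul, he, pow_one,
    PadicInt.norm_p, ← zpow_neg_one, ← zpow_add₀ (by exact_mod_cast hprime.ne_zero)]
  congr 1
  push_cast
  ring

/-- **r2's D-n.1 with a `padicValNat` certificate (odd `p`).** For the cyclotomic `ℤ_p`-extension
`κ` of `ℚ`, `p` odd, a finite place `v ∤ p` of `ℚ` and `m` with `v_p(N(v)^{p−1} − 1) = m + 1`
(`m = n_l` for `v = (l)`): `#{w ∣ v in ℚ_n} · p^{n − m} = pⁿ`. [cite: Washington1997, §13.1]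
[cite: NeukirchANT1999, Ch. I §9 Prop. (9.4)] -/
theorem card_placesOver_layer_mul_pow_eq_rat_of_padicValNat (hκ : κ.IsCyclotomic) (hp : p ≠ 2)
    {v : HeightOneSpectrum (𝓞 ℚ)} (hv : ((p : ℕ) : 𝓞 ℚ) ∉ v.asIdeal) {m : ℕ}
    (hval : padicValNat p (v.residueCard ^ (p - 1) - 1) = m + 1) :
    Nat.card {w : HeightOneSpectrum (𝓞 (κ.layer n)) // w.under (𝓞 ℚ) = v} * p ^ (n - m) =
      p ^ n :=
  card_placesOver_layer_mul_pow_eq_rat κ n hκ hv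
    (norm_pow_torsionOrder_sub_one_of_padicValNat hp hval)

/-- **Finset form** of `card_placesOver_layer_mul_pow_eq_rat_of_padicValNat` (for consumers taking a
`Finset` of places of `ℚ_n` above `v`): there is a finset `T` of places of `ℚ_n`, all above `v`,
containing every place above `v`, with `#T · p^{n − m} = pⁿ`. [cite: Washington1997, §13.1] -/
theorem exists_finset_placesOver_layer_rat_of_padicValNat (hκ : κ.IsCyclotomic) (hp : p ≠ 2)
    {v : HeightOneSpectrum (𝓞 ℚ)} (hv : ((p : ℕ) : 𝓞 ℚ) ∉ v.asIdeal) {m : ℕ}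
    (hval : padicValNat p (v.residueCard ^ (p - 1) - 1) = m + 1) :
    ∃ T : Finset (HeightOneSpectrum (𝓞 (κ.layer n))),
      (∀ w, w ∈ T ↔ w.under (𝓞 ℚ) = v) ∧ T.card * p ^ (n - m) = p ^ n := by
  classical
  haveI : Fintype {w : HeightOneSpectrum (𝓞 (κ.layer n)) // w.under (𝓞 ℚ) = v} :=
    @Fintype.ofFinite _ (finite_heightOneSpectrum_under_eq v)
  refine ⟨(Finset.univ : Finset {w : HeightOneSpectrum (𝓞 (κ.layer n)) // w.under (𝓞 ℚ) = v}).map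
    (Function.Embedding.subtype _), fun w => ?_, ?_⟩
  · simp only [Finset.mem_map, Finset.mem_univ, Function.Embedding.coe_subtype, true_and,
      Subtype.exists, exists_prop, exists_eq_right]
  · rw [Finset.card_map, Finset.card_univ, ← Nat.card_eq_fintype_card]
    exact card_placesOver_layer_mul_pow_eq_rat_of_padicValNat κ n hκ hp hv hval

end Rat

end Summit.BirchSwinnertonDyer.Rank1Residual.Additive.ZpTower

end
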